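import Summits.KontsevichZagierPeriods.KontsevichZagierPeriods.Theorems.RootDecompWalshStrataEulerDescent05

/-!
# Conic descent, gen 6 (L4 one-variable Euler descent `[T, R(x)·√(ex²+fx+g)^{±1}] ∈ InBaker`), part 6/12

Declarations `InBaker.sqrt_const_pole` … `two_sqrt_antitoneOn` of the farm-checked gen-6 monolith; see the module docstring of
`EulerDescent01` (part 1) for the overview, the design and the sources. [KontsevichZagier2001 §1.1–1.2; BCR1998 §2.2; Euler 1768; this node gen 4 `sqrtDescent_*`]
-/

noncomputable section

open Literature.NumberTheory.Transcendental
open MeasureTheory Set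
open MvPolynomial (aeval)
open Literature.ModelTheory.ExponentialFields (IsSemialgebraic isSemialgebraic_univ
  isSemialgebraic_setOf_eval_pos isSemialgebraic_setOf_eval_lt isSemialgebraic_setOf_eval_le
  isSemialgebraic_setOf_eval_nonneg isSemialgebraic_setOf_eval_eq_zero continuous_aeval_real
  tarski_seidenberg_real_holds)

namespace Summit.KontsevichZagierPeriods.RootDecompWalshStrata.ConicDescent

/-- The half-line `{t > 0}` is `ℚ`-semialgebraic (part-local `private` copy). [BCR1998 §2.2] -/
private theorem isSemialgebraic_pos' : IsSemialgebraic ℚ {v : Fin 1 → ℝ | 0 < v 0} := by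
  convert isSemialgebraic_setOf_eval_pos (k := ℚ) (R := ℝ)
    (MvPolynomial.X (0 : Fin 1) : MvPolynomial (Fin 1) ℚ) using 1
  ext v
  simp

/-- The half-line `{t > a}` is `ℚ`-semialgebraic (part-local `private` copy). [BCR1998 §2.2] -/
private theorem isSemialgebraic_gt' (a : ℚ) : IsSemialgebraic ℚ {v : Fin 1 → ℝ | (a : ℝ) < v 0} := by
  convert isSemialgebraic_setOf_eval_pos (k := ℚ) (R := ℝ)
    (MvPolynomial.X (0 : Fin 1) - MvPolynomial.C a : MvPolynomial (Fin 1) ℚ) using 1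
  ext v
  simp [sub_pos]

/-- **The scaled-log atom.**  For `0 < m ∈ ℚ` (square or not) and `a, c ∈ ℚ`:
`[T, c·√m/(x − a)] ∈ InBaker` on ANY domain.  The chart is the MÖBIUS map
`x = a + (t + √m)/(t − √m)` on `{t² ≠ m}` — `ℚ`-SEMIALGEBRAIC although its coefficients are
irrational (`√m` is a semialgebraic constant) — under which `c√m·dx/(x − a)` pulls back to the
RATIONAL form `2cm·dt/(t² − m)` (`|dx/dt| = 2√m/(t − √m)²`); the two points `x = a`, `x = a + 1`
not covered are null (rule (1a)).  This is the atom of the degenerate strata `h = 0 < e ∉ ℚ²` and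
`e = f = 0 < g ∉ ℚ²` of the conic descent (`[T, √m·R(x)]`, simple rational poles of `R`) and of
the value-level "irrationally weighted logarithms" `c√m·log α`. [this node] -/
theorem InBaker.sqrt_const_pole (m a c : ℚ) (hm : 0 < m) (r : KZ.IntegralRep 1)
    (hr : EqOn r.integrand (fun v => (c : ℝ) / (v 0 - a) * √(qD 0 0 m (v 0))) r.domain) :
    InBaker (KZ.of r) := by
  have hc1 : (((a + 1 : ℚ)) : ℝ) = (a : ℝ) + 1 := by push_cast; ring
  refine InBaker.of_split_at a r (fun r₁ hd₁ hi₁ => ?_) fun r₁ hd₁ hi₁ => ?_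
  · -- `x > a`: split again at `a + 1`
    refine InBaker.of_split_at (a + 1) r₁ (fun r₂ hd₂ hi₂ => ?_) fun r₂ hd₂ hi₂ => ?_
    · refine sqrt_const_pole_core m a c hm r₂ (fun x hx => ?_) fun v hv => ?_
      · rw [hd₂] at hx
        have h2 : (((a + 1 : ℚ)) : ℝ) < x 0 := hx.2
        rw [hc1] at h2
        exact ⟨(show (0 : ℝ) < x 0 - a by linarith).ne', (show (1 : ℝ) < x 0 - a by linarith).ne'⟩
      · rw [hd₂] at hv
        have hv₁ : v ∈ r₁.domain := hv.1
        rw [hd₁] at hv₁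
        rw [hi₂, hi₁]
        exact hr hv₁.1
    · refine sqrt_const_pole_core m a c hm r₂ (fun x hx => ?_) fun v hv => ?_
      · rw [hd₂] at hx
        have h2 : x 0 < (((a + 1 : ℚ)) : ℝ) := hx.2
        have h1 : x ∈ r₁.domain := hx.1
        rw [hd₁] at h1
        have h1' : (a : ℝ) < x 0 := h1.2
        rw [hc1] at h2
        exact ⟨(show (0 : ℝ) < x 0 - a by linarith).ne', (show x 0 - a < 1 by linarith).ne⟩
      · rw [hd₂] at hv
        have hv₁ : v ∈ r₁.domain := hv.1
        rw [hd₁] at hv₁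
        rw [hi₂, hi₁]
        exact hr hv₁.1
  · -- `x < a`
    refine sqrt_const_pole_core m a c hm r₁ (fun x hx => ?_) fun v hv => ?_
    · rw [hd₁] at hx
      have h1 : x 0 < (a : ℝ) := hx.2
      exact ⟨(show x 0 - a < 0 by linarith).ne, (show x 0 - a < 1 by linarith).ne⟩
    · rw [hd₁] at hv
      rw [hi₁]
      exact hr hv.1


/-! #### 24.8 The root-pole atom `c·√D/(x − b)`, `D(b) = 0`: inversion about the root gives a LINEAR radicand -/

/-- **The root-pole atom, right of the root.**  For `e ≠ 0`, `h ≠ 0`, a RATIONAL ROOT `b` of `D`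
and a domain inside `{x > b, D > 0}`:  `[T, c·√D/(x − b)] ∈ InBaker`.  The inversion `x = b + 1/z`
(`z > 0`) gives `z²·D(b + 1/z) = D′(b)·z + e` — a LINEAR radicand since `D(b) = 0`
(`D′(b) = 2eb + f ≠ 0` because `D′(b)² = −4e·h`) — and the integrand `(c/z²)·√(D′(b) z + e)`, an
instance of `InBaker.linear_factor`.  (The atom is integrable at `b`: order `−1/2`.) [this node] -/
theorem InBaker.root_pole_right (e f g b c : ℚ) (he : e ≠ 0) (hh : g - f ^ 2 / (4 * e) ≠ 0)
    (hDb : e * b ^ 2 + f * b + g = 0) (r : KZ.IntegralRep 1)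
    (hdom : ∀ v ∈ r.domain, (b : ℝ) < v 0 ∧ 0 < qD e f g (v 0))
    (hr : EqOn r.integrand (fun v => (c : ℝ) / (v 0 - b) * √(qD e f g (v 0))) r.domain) :
    InBaker (KZ.of r) := by
  obtain ⟨f₁, hf₁def⟩ : ∃ f₁ : ℚ, f₁ = 2 * e * b + f := ⟨_, rfl⟩
  have hf₁ : f₁ ≠ 0 := by
    intro h0
    apply hh
    have h1 : g - f ^ 2 / (4 * e) = -f₁ ^ 2 / (4 * e) + (e * b ^ 2 + f * b + g) := by
      rw [hf₁def]; field_simp; ring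
    rw [h1, h0, hDb]; simp
  have hDt' : ∀ z : ℝ, z ≠ 0 →
      qD (e * b ^ 2 + f * b + g) f₁ e z = z ^ 2 * qD e f g ((b : ℝ) + z⁻¹) := fun z hz => by
    rw [hf₁def]; simp only [qD]; push_cast; field_simp; ring
  have hDt : ∀ z : ℝ, z ≠ 0 → qD 0 f₁ e z = z ^ 2 * qD e f g ((b : ℝ) + z⁻¹) := fun z hz => by
    have h1 := hDt' z hz; rwa [hDb] at h1
  have hT₀ : IsSemialgebraic ℚ
      {v : Fin 1 → ℝ | v ∈ {v : Fin 1 → ℝ | 0 < v 0} ∧ 0 < qD 0 f₁ e (v 0)} :=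
    IsSemialgebraicFunOn.isSemialgebraic_sep_pos
      (isSemialgebraicFunOn_qD 0 f₁ e isSemialgebraic_pos')
  refine InBaker.of_invert' b r hT₀ (fun v hv => (show (0 : ℝ) < v 0 from hv.1).ne')
    (fun x hx => ?_) (fun v => (c : ℝ) / v 0 ^ 2 * √(qD 0 f₁ e (v 0))) ?_
    (fun v hv hvd => ?_) fun r₃ hd₃ hi₃ => ?_
  · -- the chart covers the domain: `z = 1/(x − b) > 0` and `D′(b) z + e = z²·D(x) > 0`
    obtain ⟨hxb, hxD⟩ := hdom x hx
    have hxb' : x 0 - b ≠ 0 := sub_ne_zero.2 hxb.ne'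
    refine ⟨hxb.ne', inv_pos.2 (sub_pos.2 hxb), ?_⟩
    change 0 < qD 0 f₁ e (x 0 - b)⁻¹
    rw [hDt _ (inv_ne_zero hxb'), inv_inv, show (b : ℝ) + (x 0 - b) = x 0 by ring]
    exact mul_pos (pow_pos (inv_pos.2 (sub_pos.2 hxb)) 2) hxD
  · -- the pulled-back integrand is semialgebraic on the chart domain
    have h1 : IsRatOn {v : Fin 1 → ℝ | v ∈ {v : Fin 1 → ℝ | 0 < v 0} ∧ 0 < qD 0 f₁ e (v 0)}
        fun v => (c : ℝ) / v 0 ^ 2 :=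
      (IsRatOn.const c).div (IsRatOn.coord.pow 2) fun v hv =>
        pow_ne_zero 2 (show (0 : ℝ) < v 0 from hv.1).ne'
    exact ((h1.isSemialgebraicFunOn hT₀).mul_holds (IsSemialgebraicFunOn.sqrt_holds
      (isSemialgebraicFunOn_qD 0 f₁ e hT₀))).congr fun v _ => by simp only [Pi.mul_apply]
  · -- the pull-back: `c/(x − b)·√D(x)·(1/z²) = (c/z²)·√(D′(b) z + e)` for `z > 0`
    have hz : (0 : ℝ) < v 0 := hv.1
    rw [hr hvd]
    beta_reduce
    have hDx : qD e f g ((b : ℝ) + (v 0)⁻¹) = qD 0 f₁ e (v 0) / v 0 ^ 2 := by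
      rw [hDt _ hz.ne', mul_div_cancel_left₀ _ (pow_ne_zero 2 hz.ne')]
    rw [show (b : ℝ) + (v 0)⁻¹ - b = (v 0)⁻¹ by ring, hDx, Real.sqrt_div' _ (sq_nonneg _),
      Real.sqrt_sq hz.le]
    have hz0 : v 0 ≠ 0 := hz.ne'
    field_simp
  · -- the pulled-back representation has a LINEAR radicand and the rational factor `c/z²`
    refine InBaker.linear_factor f₁ e hf₁ (Polynomial.C c) (Polynomial.X ^ 2) r₃
      (fun v hv => ?_) fun v hv => ?_
    · rw [hd₃] at hv
      rw [map_pow, Polynomial.aeval_X]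
      exact pow_ne_zero 2 (show (0 : ℝ) < v 0 from hv.1.1).ne'
    · rw [hi₃]; beta_reduce; rw [map_pow, Polynomial.aeval_X, Polynomial.aeval_C, eq_ratCast]

/-- **THE ROOT-POLE ATOM** on an arbitrary domain: for `e ≠ 0`, `h ≠ 0` and a rational ROOT `b`
of `D`, `[T, c·√D/(x − b)] ∈ InBaker`.  Restrict to `{D > 0}`, split at `b`; right of `b` use
`root_pole_right`; left of `b` reflect `x = 2b − t` (`D ↦ D₂`, `D₂(b) = D(b) = 0`, same `e`,
same `h`; the integrand becomes `(−c)·√D₂/(t − b)` right of `b`).  With `mirror_atom` this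
settles EVERY simple rational pole of the rational factor: at a non-root `a` of `D` by partial
fractions + `mirror_atom`, at a root `b` of `D` (where `euler_factor`'s hull hypothesis must fail,
the atom being unbounded) by this theorem. [this node] -/
theorem InBaker.root_pole_atom (e f g b c : ℚ) (he : e ≠ 0) (hh : g - f ^ 2 / (4 * e) ≠ 0)
    (hDb : e * b ^ 2 + f * b + g = 0) (r : KZ.IntegralRep 1)
    (hr : EqOn r.integrand (fun v => (c : ℝ) / (v 0 - b) * √(qD e f g (v 0))) r.domain) :
    InBaker (KZ.of r) := by
  refine InBaker.restrict_pos e f g r _ hr fun r₁ hsub hpos hr₁ => ?_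
  refine InBaker.of_split_at b r₁ (fun r₂ hd₂ hi₂ => ?_) fun r₂ hd₂ hi₂ => ?_
  · -- right of the root
    refine InBaker.root_pole_right e f g b c he hh hDb r₂ (fun v hv => ?_) fun v hv => ?_
    · rw [hd₂] at hv; exact ⟨hv.2, hpos v hv.1⟩
    · rw [hd₂] at hv; rw [hi₂]; exact hr₁ hv.1
  · -- left of the root: reflect `x = 2b − t`
    obtain ⟨f', hf'def⟩ : ∃ f' : ℚ, f' = -(4 * e * b + f) := ⟨_, rfl⟩
    obtain ⟨g', hg'def⟩ : ∃ g' : ℚ, g' = 4 * e * b ^ 2 + 2 * f * b + g := ⟨_, rfl⟩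
    have hh' : g' - f' ^ 2 / (4 * e) ≠ 0 := by
      have h4 : g' - f' ^ 2 / (4 * e) = g - f ^ 2 / (4 * e) := by
        rw [hf'def, hg'def]; field_simp; ring
      rw [h4]; exact hh
    have hDb' : e * b ^ 2 + f' * b + g' = 0 := by
      have h4 : e * b ^ 2 + f' * b + g' = e * b ^ 2 + f * b + g := by rw [hf'def, hg'def]; ring
      rw [h4]; exact hDb
    have hrefl : ∀ x : ℝ, qD e f g (2 * (b : ℝ) - x) = qD e f' g' x := fun x => by
      rw [hf'def, hg'def]; simp only [qD]; push_cast; ring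
    have hc2 : (((2 * b : ℚ)) : ℝ) = 2 * (b : ℝ) := by push_cast; ring
    have hT₀ : IsSemialgebraic ℚ
        {v : Fin 1 → ℝ | v ∈ {v : Fin 1 → ℝ | (b : ℝ) < v 0} ∧ 0 < qD e f' g' (v 0)} :=
      IsSemialgebraicFunOn.isSemialgebraic_sep_pos
        (isSemialgebraicFunOn_qD e f' g' (isSemialgebraic_gt' b))
    refine InBaker.of_reflect' (2 * b) r₂ hT₀ (fun x hx => ?_)
      (fun v => ((-c : ℚ) : ℝ) / (v 0 - b) * √(qD e f' g' (v 0))) ?_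
      (fun v hv hvd => ?_) fun r₃ hd₃ hi₃ => ?_
    · -- the mirror image of the left piece lies right of `b` inside `{D₂ > 0}`
      rw [hd₂] at hx
      obtain ⟨hx₁, hxlt⟩ := hx
      refine ⟨?_, ?_⟩
      · change (b : ℝ) < (((2 * b : ℚ)) : ℝ) - x 0
        rw [hc2]; linarith
      · change 0 < qD e f' g' ((((2 * b : ℚ)) : ℝ) - x 0)
        rw [hc2, ← hrefl, sub_sub_cancel]
        exact hpos x hx₁
    · -- semialgebraic integrand on the mirror domain
      have h1 : IsRatOn
          {v : Fin 1 → ℝ | v ∈ {v : Fin 1 → ℝ | (b : ℝ) < v 0} ∧ 0 < qD e f' g' (v 0)}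
          fun v => ((-c : ℚ) : ℝ) / (v 0 - b) :=
        (IsRatOn.const (-c)).div (IsRatOn.coord.sub (IsRatOn.const b)) fun v hv =>
          sub_ne_zero.2 (show (b : ℝ) < v 0 from hv.1).ne'
      exact ((h1.isSemialgebraicFunOn hT₀).mul_holds (IsSemialgebraicFunOn.sqrt_holds
        (isSemialgebraicFunOn_qD e f' g' hT₀))).congr fun v _ => by simp only [Pi.mul_apply]
    · -- the reflected integrand
      have hvd' : (fun _ : Fin 1 => (((2 * b : ℚ)) : ℝ) - v 0) ∈ r₁.domain := by
        rw [hd₂] at hvd; exact hvd.1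
      rw [hi₂, hr₁ hvd']
      beta_reduce
      rw [hc2, hrefl, show 2 * (b : ℝ) - v 0 - b = -(v 0 - b) by ring, div_neg]
      push_cast
      ring
    · -- the reflected piece is a right-of-the-root atom for `D₂` with constant `−c`
      refine InBaker.root_pole_right e f' g' b (-c) he hh' hDb' r₃ (fun v hv => ?_)
        fun v hv => ?_
      · rw [hd₃] at hv; exact ⟨hv.1.1, hv.1.2⟩
      · rw [hi₃]


/-! #### 24.9 Two more atoms of the scaled class `[T, √m·S(x)]`: constants and double poles (pull-backs CONSTANT) -/

/-- **The scaled constant** `[T, c·√m]`, `0 < m ∈ ℚ`: the dilation `x = s/√m` (a `ℚ`-semialgebraic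
chart with the irrational scale `1/√m`) pulls `c√m·dx` back to the RATIONAL constant form `c·ds`.
[this node] -/
theorem InBaker.sqrt_const (m c : ℚ) (hm : 0 < m) (r : KZ.IntegralRep 1)
    (hr : EqOn r.integrand (fun v => (c : ℝ) * √(qD 0 0 m (v 0))) r.domain) :
    InBaker (KZ.of r) := by
  obtain ⟨ρ, hρdef⟩ : ∃ ρ : ℝ, ρ = √(m : ℝ) := ⟨_, rfl⟩
  have hm' : (0 : ℝ) < m := by exact_mod_cast hm
  have hρ : 0 < ρ := by rw [hρdef]; exact Real.sqrt_pos.2 hm'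
  have hqD : ∀ x : ℝ, qD 0 0 m x = m := fun x => by simp [qD]
  have hT₀ : IsSemialgebraic ℚ (univ : Set (Fin 1 → ℝ)) := isSemialgebraic_univ
  have hsq : IsSemialgebraicFunOn ℚ (univ : Set (Fin 1 → ℝ)) fun _ : Fin 1 → ℝ => ρ :=
    (IsSemialgebraicFunOn.sqrt_holds (isSemialgebraicFunOn_ratCast hT₀ m)).congr
      fun v _ => by rw [hρdef]
  have hgS : IsSemialgebraicFunOn ℚ (univ : Set (Fin 1 → ℝ)) fun v => v 0 / ρ :=
    (isSemialgebraicFunOn_apply hT₀ 0).div hsq fun _ _ => hρ.ne'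
  refine InBaker.of_cov₁_rat r hT₀ (fun s : ℝ => s / ρ) (fun _ => 1 / ρ) hgS
    (fun v _ => (hasDerivAt_id' (v 0)).div_const ρ) (fun s _ t _ hst => ?_) (fun x _ => ?_)
    (fun _ => (c : ℝ)) (IsRatOn.const c) fun v _ hvd => ?_
  · exact (div_left_inj' hρ.ne').1 hst
  · exact ⟨fun _ => ρ * x 0, mem_univ _, by simp [mul_div_cancel_left₀ _ hρ.ne']⟩
  · have hx' : r.integrand (lift₁ (fun s : ℝ => s / ρ) v) = (c : ℝ) * √(qD 0 0 m (v 0 / ρ)) :=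
      hr hvd
    rw [hx', hqD, ← hρdef, abs_of_pos (by positivity : (0 : ℝ) < 1 / ρ)]
    field_simp

/-- Core of `InBaker.sqrt_const_dpole`: the chart `x = a + √m/s` on `{s ≠ 0}` for a domain
avoiding `x = a`; the pull-back of `c√m·dx/(x − a)²` is the CONSTANT `c` (up to the sign absorbed
by `|dx/ds|`). [this node] -/
theorem sqrt_const_dpole_core (m a c : ℚ) (hm : 0 < m) (r' : KZ.IntegralRep 1)
    (hcov : ∀ x ∈ r'.domain, x 0 - a ≠ 0)
    (hr : EqOn r'.integrand (fun v => (c : ℝ) / (v 0 - a) ^ 2 * √(qD 0 0 m (v 0))) r'.domain) :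
    InBaker (KZ.of r') := by
  obtain ⟨ρ, hρdef⟩ : ∃ ρ : ℝ, ρ = √(m : ℝ) := ⟨_, rfl⟩
  have hm' : (0 : ℝ) < m := by exact_mod_cast hm
  have hρ : 0 < ρ := by rw [hρdef]; exact Real.sqrt_pos.2 hm'
  have hqD : ∀ x : ℝ, qD 0 0 m x = m := fun x => by simp [qD]
  obtain ⟨T₀, hT₀def⟩ : ∃ T₀ : Set (Fin 1 → ℝ),
      T₀ = {v | v ∈ (univ : Set (Fin 1 → ℝ)) ∧ v 0 ≠ 0} := ⟨_, rfl⟩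
  have hT₀ : IsSemialgebraic ℚ T₀ := by
    rw [hT₀def]; exact IsRatOn.isSemialgebraic_sep_ne_zero isSemialgebraic_univ IsRatOn.coord
  have hT₀' : ∀ v ∈ T₀, v 0 ≠ 0 := fun v hv => by rw [hT₀def] at hv; exact hv.2
  have hsq : IsSemialgebraicFunOn ℚ T₀ fun _ : Fin 1 → ℝ => ρ :=
    (IsSemialgebraicFunOn.sqrt_holds (isSemialgebraicFunOn_ratCast hT₀ m)).congr
      fun v _ => by rw [hρdef]
  have hgS : IsSemialgebraicFunOn ℚ T₀ fun v => (a : ℝ) + ρ * (v 0)⁻¹ :=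
    ((isSemialgebraicFunOn_ratCast hT₀ a).add_holds (hsq.mul_holds
      ((isSemialgebraicFunOn_apply hT₀ 0).inv hT₀'))).congr fun v _ => by
        simp only [Pi.add_apply, Pi.mul_apply]
  refine InBaker.of_cov₁_rat r' hT₀ (fun s : ℝ => (a : ℝ) + ρ * s⁻¹) (fun s => ρ * -(s ^ 2)⁻¹)
    hgS (fun v hv => ((hasDerivAt_inv (hT₀' v hv)).const_mul ρ).const_add (a : ℝ))
    (fun s hs t ht hst => ?_) (fun x hx => ?_) (fun _ => (c : ℝ)) (IsRatOn.const c)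
    fun v hv hvd => ?_
  · have h1 : ρ * (s 0)⁻¹ = ρ * (t 0)⁻¹ := by
      have h := hst
      simp only [add_right_inj] at h
      exact h
    exact inv_inj.1 (mul_left_cancel₀ hρ.ne' h1)
  · have hy := hcov x hx
    refine ⟨fun _ => ρ / (x 0 - a), ?_, ?_⟩
    · rw [hT₀def]; exact ⟨mem_univ _, div_ne_zero hρ.ne' hy⟩
    · change (a : ℝ) + ρ * (ρ / (x 0 - a))⁻¹ = x 0
      rw [inv_div, ← mul_div_assoc, mul_div_cancel_left₀ _ hρ.ne']; ring
  · have hs := hT₀' v hv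
    have hx' : r'.integrand (lift₁ (fun s : ℝ => (a : ℝ) + ρ * s⁻¹) v) =
        (c : ℝ) / ((a : ℝ) + ρ * (v 0)⁻¹ - a) ^ 2 * √(qD 0 0 m ((a : ℝ) + ρ * (v 0)⁻¹)) := hr hvd
    rw [hx', hqD, ← hρdef, add_sub_cancel_left, abs_mul, abs_neg, abs_inv, abs_of_pos hρ,
      abs_of_nonneg (sq_nonneg _)]
    have hρ0 := hρ.ne'
    field_simp

/-- **The scaled double pole** `[T, c·√m/(x − a)²]`, `0 < m ∈ ℚ`, `a, c ∈ ℚ`, on ANY domain: the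
chart `x = a + √m/s` pulls `c√m·dx/(x − a)²` back to the CONSTANT form `c·ds`; the point `x = a`
is null.  (Simple poles: `sqrt_const_pole`; constants: `sqrt_const`.) [this node] -/
theorem InBaker.sqrt_const_dpole (m a c : ℚ) (hm : 0 < m) (r : KZ.IntegralRep 1)
    (hr : EqOn r.integrand (fun v => (c : ℝ) / (v 0 - a) ^ 2 * √(qD 0 0 m (v 0))) r.domain) :
    InBaker (KZ.of r) := by
  refine InBaker.of_split_at a r (fun r₁ hd₁ hi₁ => ?_) fun r₁ hd₁ hi₁ => ?_
  · refine sqrt_const_dpole_core m a c hm r₁ (fun x hx => ?_) fun v hv => ?_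
    · rw [hd₁] at hx
      exact sub_ne_zero.2 (show (a : ℝ) < x 0 from hx.2).ne'
    · rw [hd₁] at hv; rw [hi₁]; exact hr hv.1
  · refine sqrt_const_dpole_core m a c hm r₁ (fun x hx => ?_) fun v hv => ?_
    · rw [hd₁] at hx
      exact sub_ne_zero.2 (show x 0 < (a : ℝ) from hx.2).ne
    · rw [hd₁] at hv; rw [hi₁]; exact hr hv.1


/-! #### 24.10 Integrability at boundary roots of `D`: `F/√D` with `F` bounded, on a bounded `T ⊆ {D > 0}` -/

/-- Derivative of the quadratic `D`. [folklore] -/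
theorem hasDerivAt_qD (e f g : ℚ) (x : ℝ) :
    HasDerivAt (fun y => qD e f g y) (2 * (e : ℝ) * x + f) x := by
  have h : HasDerivAt (fun y : ℝ => (e : ℝ) * y ^ 2 + (f : ℝ) * y + (g : ℝ))
      ((e : ℝ) * ((2 : ℕ) * x ^ (2 - 1)) + (f : ℝ) * 1) x :=
    (((hasDerivAt_pow 2 x).const_mul (e : ℝ)).add ((hasDerivAt_id' x).const_mul (f : ℝ))).add_const _
  exact h.congr_deriv (by push_cast; ring)

/-- The discriminant identity `D′(x)² = Δ + 4e·D(x)`, `Δ = f² − 4eg`. [folklore] -/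
theorem disc_identity (e f g : ℚ) (x : ℝ) :
    (2 * (e : ℝ) * x + f) ^ 2 = ((f ^ 2 - 4 * e * g : ℚ) : ℝ) + 4 * (e : ℝ) * qD e f g x := by
  simp only [qD]; push_cast; ring

/-- DOMINATION: for a non-degenerate quadratic (`Δ ≠ 0`) there are constants `A, B ≥ 0` with
`1 ≤ A·|D′| + B·√D` on `{D > 0}` — where `D` is small, `|D′| ≥ √(Δ/2)` (real roots are simple);
where it is not, `√D` is bounded below. Hence `1/√D ≤ A·|D′|/√D + B`. [folklore] -/
theorem exists_dom_consts (e f g : ℚ) (hΔ : f ^ 2 - 4 * e * g ≠ 0) :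
    ∃ A B : ℝ, 0 ≤ A ∧ 0 ≤ B ∧
      ∀ x : ℝ, 0 < qD e f g x → 1 ≤ A * |2 * (e : ℝ) * x + f| + B * √(qD e f g x) := by
  obtain ⟨Δ, hΔdef⟩ : ∃ Δ : ℚ, Δ = f ^ 2 - 4 * e * g := ⟨_, rfl⟩
  rw [← hΔdef] at hΔ
  have hid : ∀ x : ℝ, (2 * (e : ℝ) * x + f) ^ 2 = (Δ : ℝ) + 4 * (e : ℝ) * qD e f g x := by
    intro x; rw [hΔdef]; exact disc_identity e f g x
  rcases lt_or_gt_of_ne hΔ with hneg | hpos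
  · have hΔr : (Δ : ℝ) < 0 := by exact_mod_cast hneg
    by_cases he : 0 < e
    · have her : (0 : ℝ) < e := by exact_mod_cast he
      obtain ⟨B, hB0, hB2⟩ : ∃ B : ℝ, 0 ≤ B ∧ B ^ 2 * (-(Δ : ℝ)) = 4 * e := by
        refine ⟨√(4 * e / -Δ), Real.sqrt_nonneg _, ?_⟩
        rw [Real.sq_sqrt (div_nonneg (by positivity) (by linarith))]
        field_simp
      refine ⟨0, B, le_rfl, hB0, fun x hx => ?_⟩
      have hs2 : √(qD e f g x) ^ 2 = qD e f g x := Real.sq_sqrt hx.le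
      have hs0 : 0 ≤ √(qD e f g x) := Real.sqrt_nonneg _
      have h4 : -(Δ : ℝ) ≤ 4 * e * qD e f g x := by
        nlinarith [sq_nonneg (2 * (e : ℝ) * x + f), hid x]
      have key : 1 ≤ (B * √(qD e f g x)) ^ 2 := by
        rw [mul_pow, hs2]
        nlinarith [hB2, h4, sq_nonneg B, her]
      rw [zero_mul, zero_add]
      nlinarith [key, mul_nonneg hB0 hs0]
    · refine ⟨0, 0, le_rfl, le_rfl, fun x hx => ?_⟩
      exfalso
      have her : (e : ℝ) ≤ 0 := by exact_mod_cast not_lt.1 he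
      have h1 : qD e f g x * (e : ℝ) ≤ 0 := mul_nonpos_iff.2 (Or.inl ⟨hx.le, her⟩)
      nlinarith [sq_nonneg (2 * (e : ℝ) * x + f), hid x]
  · have hΔr : (0 : ℝ) < Δ := by exact_mod_cast hpos
    obtain ⟨A, hA0, hA2⟩ : ∃ A : ℝ, 0 ≤ A ∧ A ^ 2 * Δ = 1 :=
      ⟨√(1 / Δ), Real.sqrt_nonneg _, by rw [Real.sq_sqrt (by positivity)]; field_simp⟩
    obtain ⟨B, hB0, hB2⟩ : ∃ B : ℝ, 0 ≤ B ∧ B ^ 2 * Δ = 4 * |(e : ℝ)| :=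
      ⟨√(4 * |(e : ℝ)| / Δ), Real.sqrt_nonneg _, by rw [Real.sq_sqrt (by positivity)]; field_simp⟩
    refine ⟨A, B, hA0, hB0, fun x hx => ?_⟩
    have hy0 : 0 ≤ |2 * (e : ℝ) * x + f| := abs_nonneg _
    have hs0 : 0 ≤ √(qD e f g x) := Real.sqrt_nonneg _
    have hs2 : √(qD e f g x) ^ 2 = qD e f g x := Real.sq_sqrt hx.le
    have hy2 : |2 * (e : ℝ) * x + f| ^ 2 = (Δ : ℝ) + 4 * e * √(qD e f g x) ^ 2 := by
      rw [sq_abs, hs2, hid x]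
    have h4 : 0 ≤ 4 * (e : ℝ) * A ^ 2 + B ^ 2 := by
      have h : (4 * (e : ℝ) * A ^ 2 + B ^ 2) * Δ = 4 * e + 4 * |(e : ℝ)| := by
        linear_combination 4 * (e : ℝ) * hA2 + hB2
      have h' : 0 ≤ (4 * (e : ℝ) * A ^ 2 + B ^ 2) * Δ := by
        rw [h]; linarith [neg_abs_le (e : ℝ)]
      exact (mul_nonneg_iff_of_pos_right hΔr).1 h'
    have key : 1 ≤ (A * |2 * (e : ℝ) * x + f| + B * √(qD e f g x)) ^ 2 := by
      have hexp : (A * |2 * (e : ℝ) * x + f| + B * √(qD e f g x)) ^ 2 =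
          A ^ 2 * Δ + (4 * e * A ^ 2 + B ^ 2) * √(qD e f g x) ^ 2 +
            2 * (A * |2 * (e : ℝ) * x + f|) * (B * √(qD e f g x)) := by
        rw [show (A * |2 * (e : ℝ) * x + f| + B * √(qD e f g x)) ^ 2 =
          A ^ 2 * |2 * (e : ℝ) * x + f| ^ 2 + B ^ 2 * √(qD e f g x) ^ 2 +
            2 * (A * |2 * (e : ℝ) * x + f|) * (B * √(qD e f g x)) by ring, hy2]
        ring
      rw [hexp, hA2]
      nlinarith [mul_nonneg h4 (sq_nonneg (√(qD e f g x))),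
        mul_nonneg (mul_nonneg hA0 hy0) (mul_nonneg hB0 hs0)]
    nlinarith [key, mul_nonneg hA0 hy0, mul_nonneg hB0 hs0]

/-- `2√D` is monotone where `D` is non-decreasing, antitone where it is non-increasing. -/
theorem two_sqrt_monotoneOn (e f g : ℚ) {s : Set ℝ}
    (h : ∀ a ∈ s, ∀ b ∈ s, a ≤ b → qD e f g a ≤ qD e f g b) :
    MonotoneOn (fun x => 2 * √(qD e f g x)) s := fun a ha b hb hab =>
  mul_le_mul_of_nonneg_left (Real.sqrt_le_sqrt (h a ha b hb hab)) (by norm_num)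

/-- `2√D` is antitone where `D` is non-increasing. -/
theorem two_sqrt_antitoneOn (e f g : ℚ) {s : Set ℝ}
    (h : ∀ a ∈ s, ∀ b ∈ s, a ≤ b → qD e f g b ≤ qD e f g a) :
    AntitoneOn (fun x => 2 * √(qD e f g x)) s := fun a ha b hb hab =>
  mul_le_mul_of_nonneg_left (Real.sqrt_le_sqrt (h a ha b hb hab)) (by norm_num)

end Summit.KontsevichZagierPeriods.RootDecompWalshStrata.ConicDescent
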